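import Summits.Ventures.HodgeRepro.Tier3LemmaRGenerator
import Summits.Ventures.HodgeRepro.Tier3WeilLineRestriction

/-!
# LEMMA R's generator with its eigenbasis relations exported, and the Weil line it generates identified with
`∧^{2k}_K V_B` by statement — Deligne's direct summand on the data of `exists_weil_line_generator`

Blind re-derivation cell `pub-hodge-repro`, seat `t3-p4` (Tier 3, T3.5 for T3.4 = Lemma R).  Target tree path
`lean/Summits/Ventures/HodgeRepro/Tier3LemmaRGeneratorEigen.lean`; imports the cell's `Tier3LemmaRGenerator` and
`Tier3WeilLineRestriction` (hence `Tier3WedgeRestrictScalars`, `Tier3LemmaRWeilLine`, `Tier3PullbackDictionary`, …).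

WHY THIS FILE (LEMMA-R-RESIDUE.md v14 §18, the composability remark).  `Tier3LemmaRGenerator.exists_weil_line_generator`
exports the Galois EQUIVARIANCE of its eigenbasis `e′` but not its EIGEN-RELATION `(1 ⊗ b) e′(i, x) = x(b) • e′(i, x)`
(its proof takes `e′` from `Tier3PullbackDictionary.exists_equivariant_eigenbasis_pullback`, which has it in the diagonal
form `(1 ⊗ A′ b) e′(i, x) = x(bᵢ) • e′(i, x)`).  `Tier3WeilLineRestriction.weil_line_restrictScalars` — the Weil line
`W_F` IS `∧^{2k}_K V_B` through the restriction-of-scalars map `q`, `⋀[F₀]^{2k} V_B = W_F ⊕ ker q` (D1 Lemma 4.3(b)) —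
needs that relation as a hypothesis, so it applied to the generator's `W_F` only «by the proof».  This file closes the
gap BY STATEMENT:

* `exists_weil_line_generator_eigen` = `exists_weil_line_generator` with three clauses added right after the two
  equivariance clauses — the diagonal eigen-relations of `e` and `e′` under `A b = (ω_j ↦ b_j • ω_j)`,
  `A′ b = (ω′_i ↦ b_i • ω′_i)` (the (S2) operators of `Tier3LemmaRCorrespondence`) and the scalar eigen-relation of `e′`
  (`Tier3WedgeRestrictScalars.lTensor_lsmul_eigen_of_diag`, the constant-vector case); the proof is the generator's,
  re-run with the clauses kept.
* `exists_weil_line_generator_restrictScalars` = the former with the restriction-of-scalars map `q` and the six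
  clauses of `weil_line_restrictScalars` + `exists_weil_line_section`: `q(v₁ ∧_{F₀} ⋯ ∧ v_{2k}) = v₁ ∧_K ⋯ ∧ v_{2k}`,
  `q` onto, `(1 ⊗ q) E′_L = 0` off the `σ`-lines, `(1 ⊗ q) E′_{L_σ}` a `σ`-eigenvector («`W_F(B) ⊗ ℂ = ⊕_σ ⊗_i ℓ^{(i)}_σ`»),
  the line images a `K`-basis of `K ⊗ ⋀[K]^{2k} V_B`, `q` injective on `W_F`, `W_F` onto `⋀[K]^{2k} V_B`,
  `IsCompl W_F (ker q)`, and Deligne's section `s` with image `W_F` — for THE `W_F` that LEMMA R's generator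
  `e₀ (⋀^{2k} M η)` spans under the first corner's `K`-action.

Read with `V_red = H¹(B_red, ℚ)`, `V_B = H¹(B, ℚ)`, `K = F`, `F₀ = ℚ`, `2k = 2p`: the Weil line of LEMMA R's conclusion is
`∧^{2p}_F H¹(B, ℚ)` embedded by Deligne's lemma, `H^{2p}(B, ℚ) = ∧^{2p}_ℚ H¹(B, ℚ) = W_F(B) ⊕ ker q`, in ONE statement
with the generator.  Nothing mathematical moves (LEMMA-R-RESIDUE v14: residue 0 unchanged); this is the one-clause
re-export §18 labelled for a successor.

HONESTY.  Linear algebra on the cell's own modules; no definition is introduced; nothing geometric is built.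
HC_CM is NOT proved by anyone in this repository.
-/

set_option autoImplicit false

open TensorProduct Finset

namespace HodgeRepro.Tier3

open HodgeRepro.RouteC HodgeRepro.CMHodgeOn

section GeneratorEigen

variable {F₀ K : Type*} [Field F₀] [Field K] [Algebra F₀ K]
variable {Vr VB : Type*} [AddCommGroup Vr] [Module K Vr] [Module F₀ Vr] [IsScalarTower F₀ K Vr]
  [AddCommGroup VB] [Module K VB] [Module F₀ VB] [IsScalarTower F₀ K VB]
variable {J ι : Type*} [Fintype J] [DecidableEq J] [Fintype ι] [DecidableEq ι] [DecidableEq (K ≃ₐ[F₀] K)]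
variable [FiniteDimensional F₀ K] [IsGalois F₀ K] [Algebra K ℂ]

/-- **LEMMA R's generator with the eigen-relations exported** (`Tier3LemmaRGenerator.exists_weil_line_generator` with
three clauses added after the equivariance clauses: `(1 ⊗ A b) e(j, x) = x(b_j) • e(j, x)`,
`(1 ⊗ A′ b) e′(i, x) = x(b_i) • e′(i, x)` for the diagonal operators `A b = (ω_j ↦ b_j • ω_j)`, `A′ b = (ω′_i ↦ b_i • ω′_i)`,
and `(1 ⊗ b) e′(i, x) = x(b) • e′(i, x)` for the scalars `b ∈ K`).  Everything else — the base changes `Φ`, `Φ′`, the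
wedge bases `E`, `E′`, the Weil line `W_F` with its rational projector `e₀`, `dim_{F₀} W_F = [K : F₀]`, and for every
`W ⊇` the reduced-set wedges (Pohlmann) a non-zero `η ∈ W` with `w₀ = e₀ (⋀^{2k} M η) ∈ W_F`, `w₀ ≠ 0`,
`W_F = {act(a) w₀ : a ∈ K}` — is stated verbatim. -/
theorem exists_weil_line_generator_eigen {k : ℕ} [Nonempty ι]
    (cls : ι → J) (tw : ι → K ≃ₐ[F₀] K) (hinj : Function.Injective fun i => (cls i, tw i))
    (hcard : Fintype.card ι = 2 * k)
    (ω : Module.Basis J K Vr) (ω' : Module.Basis ι K VB) (M : Vr →ₗ[F₀] VB)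
    (hM : ∀ (c : K) (j : J), M (c • ω j) = ∑ i ∈ univ.filter (fun i => cls i = j), ((tw i)⁻¹ c) • ω' i)
    [LinearOrder (J × (K ≃ₐ[F₀] K))] [LinearOrder (ι × (K ≃ₐ[F₀] K))]
    [MulAction (K ≃ₐ[F₀] K) (J × (K ≃ₐ[F₀] K))]
    (hact : ∀ (σ x : K ≃ₐ[F₀] K) (j : J), σ • (j, x) = (j, σ * x))
    [MulAction (K ≃ₐ[F₀] K) (ι × (K ≃ₐ[F₀] K))]
    (hact' : ∀ (σ x : K ≃ₐ[F₀] K) (i : ι), σ • (i, x) = (i, σ * x))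
    (i₀ : ι) :
    ∃ (e : Module.Basis (J × (K ≃ₐ[F₀] K)) K (K ⊗[F₀] Vr))
      (E : Module.Basis (Set.powersetCard (J × (K ≃ₐ[F₀] K)) (2 * k)) K (K ⊗[F₀] ⋀[F₀]^(2 * k) Vr))
      (Φ : K ⊗[F₀] ⋀[F₀]^(2 * k) Vr ≃ₗ[K] ⋀[K]^(2 * k) (K ⊗[F₀] Vr))
      (e' : Module.Basis (ι × (K ≃ₐ[F₀] K)) K (K ⊗[F₀] VB))
      (E' : Module.Basis (Set.powersetCard (ι × (K ≃ₐ[F₀] K)) (2 * k)) K (K ⊗[F₀] ⋀[F₀]^(2 * k) VB))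
      (Φ' : K ⊗[F₀] ⋀[F₀]^(2 * k) VB ≃ₗ[K] ⋀[K]^(2 * k) (K ⊗[F₀] VB))
      (WF : Submodule F₀ (⋀[F₀]^(2 * k) VB))
      (e₀ : ⋀[F₀]^(2 * k) VB →ₗ[F₀] ⋀[F₀]^(2 * k) VB),
      (∀ (σ x : K ≃ₐ[F₀] K) (j : J), LinearMap.rTensor Vr σ.toLinearMap (e (j, x)) = e (j, σ * x)) ∧
      (∀ (σ x : K ≃ₐ[F₀] K) (i : ι), LinearMap.rTensor VB σ.toLinearMap (e' (i, x)) = e' (i, σ * x)) ∧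
      -- the eigen-relations of `e`, `e′` under the diagonal actions `A b`, `A′ b` and under the scalars of `K`
      (∀ (x : K ≃ₐ[F₀] K) (j : J) (b : J → K),
        LinearMap.lTensor K ((ω.constr K fun j => b j • ω j).restrictScalars F₀) (e (j, x)) =
          x (b j) • e (j, x)) ∧
      (∀ (x : K ≃ₐ[F₀] K) (i : ι) (b : ι → K),
        LinearMap.lTensor K ((ω'.constr K fun i => b i • ω' i).restrictScalars F₀) (e' (i, x)) =
          x (b i) • e' (i, x)) ∧
      (∀ (x : K ≃ₐ[F₀] K) (i : ι) (b : K),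
        LinearMap.lTensor K ((LinearMap.lsmul K VB b).restrictScalars F₀) (e' (i, x)) = x b • e' (i, x)) ∧
      (∀ (x : K ≃ₐ[F₀] K) (j : J),
        LinearMap.lTensor K M (e (j, x)) = ∑ i ∈ univ.filter (fun i => cls i = j), e' (i, x * tw i)) ∧
      (∀ (c : K) (v : Fin (2 * k) → Vr),
        Φ (c ⊗ₜ[F₀] exteriorPower.ιMulti F₀ (2 * k) v) =
          c • exteriorPower.ιMulti K (2 * k) (fun i => (1 : K) ⊗ₜ[F₀] v i)) ∧
      (∀ (c : K) (w : Fin (2 * k) → VB),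
        Φ' (c ⊗ₜ[F₀] exteriorPower.ιMulti F₀ (2 * k) w) =
          c • exteriorPower.ιMulti K (2 * k) (fun i => (1 : K) ⊗ₜ[F₀] w i)) ∧
      (∀ s, Φ (E s) = exteriorPower.ιMulti_family K (2 * k) e s) ∧
      (∀ s, Φ' (E' s) = exteriorPower.ιMulti_family K (2 * k) e' s) ∧
      -- the Weil line and its rational projector
      WF.baseChange K =
        Submodule.span K (E' '' {L | ∃ σ : K ≃ₐ[F₀] K, (L : Finset (ι × (K ≃ₐ[F₀] K))) = lineSet σ}) ∧
      (∀ v, e₀ v ∈ WF) ∧ (∀ w ∈ WF, e₀ w = w) ∧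
      (∀ (v : ⋀[F₀]^(2 * k) VB) (L : Set.powersetCard (ι × (K ≃ₐ[F₀] K)) (2 * k)),
        E'.repr ((1 : K) ⊗ₜ[F₀] e₀ v) L =
          if ∃ σ : K ≃ₐ[F₀] K, (L : Finset (ι × (K ≃ₐ[F₀] K))) = lineSet σ
          then E'.repr ((1 : K) ⊗ₜ[F₀] v) L else 0) ∧
      Module.finrank F₀ WF = Module.finrank F₀ K ∧
      -- LEMMA R: the generator `e · m^* η` of the Weil line under the first corner's `K`-action
      ∀ (W : Submodule F₀ (⋀[F₀]^(2 * k) Vr)),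
        (∀ s : Set.powersetCard (J × (K ≃ₐ[F₀] K)) (2 * k),
          (∃ σ, (s : Finset (J × (K ≃ₐ[F₀] K))) = reducedSet cls tw σ) → E s ∈ W.baseChange K) →
        ∃ η ∈ W, η ≠ 0 ∧
          e₀ (exteriorPower.map (2 * k) M η) ∈ WF ∧ e₀ (exteriorPower.map (2 * k) M η) ≠ 0 ∧
          ∀ x ∈ WF, ∃ a : K, x = exteriorPower.map (2 * k)
            ((ω'.constr K fun i => Function.update (fun _ => (1 : K)) i₀ a i • ω' i).restrictScalars F₀)
            (e₀ (exteriorPower.map (2 * k) M η)) := by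
  classical
  -- the eigenbasis pair with the pull-back relation (Tier3PullbackDictionary)
  obtain ⟨e, e', he1, he2, he1', he2', hMe⟩ := exists_equivariant_eigenbasis_pullback ω ω'
    (fun b => ω.constr K fun j => b j • ω j) (fun b j => by rw [Module.Basis.constr_basis])
    (fun b => ω'.constr K fun i => b i • ω' i) (fun b i => by rw [Module.Basis.constr_basis])
    cls tw M hM
  have hequiv' : ∀ (σ : K ≃ₐ[F₀] K) (p : ι × (K ≃ₐ[F₀] K)),
      LinearMap.rTensor VB σ.toLinearMap (e' p) = e' (σ • p) := by
    rintro σ ⟨i, x⟩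
    rw [hact', he1']
  obtain ⟨Φ, hΦ⟩ := exists_wedgeBaseChange (F₀ := F₀) (K := K) (V := Vr) (2 * k)
  obtain ⟨Φ', hΦ'⟩ := exists_wedgeBaseChange (F₀ := F₀) (K := K) (V := VB) (2 * k)
  obtain ⟨E, hEdef⟩ : ∃ E : Module.Basis (Set.powersetCard (J × (K ≃ₐ[F₀] K)) (2 * k)) K
      (K ⊗[F₀] ⋀[F₀]^(2 * k) Vr), E = (e.exteriorPower (2 * k)).map Φ.symm := ⟨_, rfl⟩
  obtain ⟨E', hE'def⟩ : ∃ E' : Module.Basis (Set.powersetCard (ι × (K ≃ₐ[F₀] K)) (2 * k)) K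
      (K ⊗[F₀] ⋀[F₀]^(2 * k) VB), E' = (e'.exteriorPower (2 * k)).map Φ'.symm := ⟨_, rfl⟩
  have hE : ∀ s, Φ (E s) = exteriorPower.ιMulti_family K (2 * k) e s := by
    intro s
    rw [hEdef, Module.Basis.map_apply, LinearEquiv.apply_symm_apply, exteriorPower.basis_apply]
  have hE' : ∀ s, Φ' (E' s) = exteriorPower.ιMulti_family K (2 * k) e' s := by
    intro s
    rw [hE'def, Module.Basis.map_apply, LinearEquiv.apply_symm_apply, exteriorPower.basis_apply]
  -- the `σ`-lines as `2k`-subsets, and their finite set `P`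
  have hcardL : ∀ σ : K ≃ₐ[F₀] K, (lineSet (ι := ι) σ).card = 2 * k := by
    intro σ
    rw [card_lineSet, hcard]
  obtain ⟨U, hU⟩ : ∃ U : (K ≃ₐ[F₀] K) → Set.powersetCard (ι × (K ≃ₐ[F₀] K)) (2 * k),
      ∀ σ, (U σ : Finset (ι × (K ≃ₐ[F₀] K))) = lineSet σ :=
    ⟨fun σ => ⟨lineSet σ, Set.powersetCard.mem_iff.mpr (hcardL σ)⟩, fun σ => rfl⟩
  have hmemU : ∀ (σ : K ≃ₐ[F₀] K) (p : ι × (K ≃ₐ[F₀] K)), p ∈ U σ ↔ p.2 = σ := by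
    intro σ p
    rw [← Set.powersetCard.mem_coe_iff, hU σ, mem_lineSet]
  have hUinj : Function.Injective U := by
    intro σ τ h
    obtain ⟨i⟩ := ‹Nonempty ι›
    have h1 : (i, σ) ∈ U τ := by rw [← h, hmemU]
    rw [hmemU] at h1
    exact h1
  obtain ⟨P, hPdef⟩ : ∃ P : Finset (Set.powersetCard (ι × (K ≃ₐ[F₀] K)) (2 * k)), P = Finset.univ.image U :=
    ⟨_, rfl⟩
  have hmemP : ∀ L : Set.powersetCard (ι × (K ≃ₐ[F₀] K)) (2 * k),
      L ∈ P ↔ ∃ σ : K ≃ₐ[F₀] K, (L : Finset (ι × (K ≃ₐ[F₀] K))) = lineSet σ := by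
    intro L
    rw [hPdef, Finset.mem_image]
    constructor
    · rintro ⟨σ, -, rfl⟩
      exact ⟨σ, hU σ⟩
    · rintro ⟨σ, hσ⟩
      exact ⟨σ, Finset.mem_univ _, Subtype.ext ((hU σ).trans hσ.symm)⟩
  have hP : ∀ (τ : K ≃ₐ[F₀] K), ∀ L ∈ P, ∃ L' ∈ P, ∀ p, p ∈ L' ↔ ∃ q ∈ L, τ • q = p := by
    intro τ L hL
    rw [hPdef] at hL
    obtain ⟨σ, -, rfl⟩ := Finset.mem_image.mp hL
    refine ⟨U (τ * σ), by rw [hPdef]; exact Finset.mem_image_of_mem U (Finset.mem_univ _), fun p => ?_⟩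
    rw [hmemU]
    constructor
    · intro hp
      refine ⟨(p.1, σ), (hmemU σ _).mpr rfl, ?_⟩
      rw [hact', ← hp]
    · rintro ⟨q, hq, rfl⟩
      rw [hmemU] at hq
      obtain ⟨q1, q2⟩ := q
      rw [hact']
      simp only at hq
      rw [hq]
  -- the Weil line and its rational projector (Tier3WeilProjector via Tier3LemmaRWeilLine §1)
  obtain ⟨WF, e₀, hWF, he₀mem, he₀id, he₀tmul⟩ :=
    exists_rational_projector_wedge (2 * k) e' hequiv' Φ' hΦ' P hP
  rw [← hE'def] at hWF he₀tmul
  have hWF' : WF.baseChange K =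
      Submodule.span K (E' '' {L | ∃ σ : K ≃ₐ[F₀] K, (L : Finset (ι × (K ≃ₐ[F₀] K))) = lineSet σ}) := by
    rw [hWF]
    congr 2
    ext L
    exact hmemP L
  -- the coordinate description of the projector
  have hrepr : ∀ (v : ⋀[F₀]^(2 * k) VB) (L : Set.powersetCard (ι × (K ≃ₐ[F₀] K)) (2 * k)),
      E'.repr ((1 : K) ⊗ₜ[F₀] e₀ v) L =
        if ∃ σ : K ≃ₐ[F₀] K, (L : Finset (ι × (K ≃ₐ[F₀] K))) = lineSet σ
        then E'.repr ((1 : K) ⊗ₜ[F₀] v) L else 0 := by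
    intro v L
    have hsum : E'.repr (∑ s ∈ P, E'.repr ((1 : K) ⊗ₜ[F₀] v) s • E' s) L =
        if L ∈ P then E'.repr ((1 : K) ⊗ₜ[F₀] v) L else 0 := by
      rw [map_sum, Finsupp.finsetSum_apply]
      simp only [map_smul, Module.Basis.repr_self, Finsupp.smul_single, smul_eq_mul, mul_one,
        Finsupp.single_apply]
      rw [Finset.sum_ite_eq' P L]
    rw [he₀tmul v, hsum]
    by_cases hLP : L ∈ P
    · rw [if_pos hLP, if_pos ((hmemP L).mp hLP)]
    · rw [if_neg hLP, if_neg (fun h => hLP ((hmemP L).mpr h))]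
  -- the dimension count (Tier3WeilProjector)
  have hdim : Module.finrank F₀ WF = Module.finrank F₀ K :=
    finrank_eq_finrank_of_baseChange_eq_span_image E' U hUinj WF (by rw [hWF, hPdef])
  -- the scalar eigen-relation of `e′` is the constant-vector case of the diagonal one (Tier3WedgeRestrictScalars)
  have hscal : ∀ (x : K ≃ₐ[F₀] K) (i : ι) (b : K),
      LinearMap.lTensor K ((LinearMap.lsmul K VB b).restrictScalars F₀) (e' (i, x)) = x b • e' (i, x) :=
    fun x i b => lTensor_lsmul_eigen_of_diag ω' (fun b => ω'.constr K fun i => b i • ω' i)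
      (fun b i => by rw [Module.Basis.constr_basis]) e' he2' x i b
  refine ⟨e, E, Φ, e', E', Φ', WF, e₀, he1, he1', he2, he2', hscal, hMe, hΦ, hΦ', hE, hE', hWF', he₀mem, he₀id,
    hrepr, hdim, ?_⟩
  intro W hPW
  -- LEMMA R's non-vanishing for these bases (Tier3LemmaRWeilLine §3)
  obtain ⟨η, hηW, hη0, hcoef⟩ := exists_rational_class_repr_lineSet_ne_zero_of_data cls tw hinj hcard ω ω' M
    hact e e' he1 he2 he2' hMe Φ hΦ Φ' hΦ' W (by rw [← hEdef]; exact hPW)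
  rw [← hE'def] at hcoef
  obtain ⟨w₀, hw₀def⟩ : ∃ w₀ : ⋀[F₀]^(2 * k) VB, w₀ = e₀ (exteriorPower.map (2 * k) M η) := ⟨_, rfl⟩
  obtain ⟨c, hcdef⟩ : ∃ c : (K ≃ₐ[F₀] K) → K,
      c = fun σ => E'.repr ((1 : K) ⊗ₜ[F₀] exteriorPower.map (2 * k) M η) (U σ) := ⟨_, rfl⟩
  have hc : ∀ σ, c σ ≠ 0 := fun σ => by rw [hcdef]; exact hcoef σ (U σ) (hU σ)
  -- `1 ⊗ w₀ = Σ_σ c_σ • E′_{L_σ}`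
  have hw₀tmul : (1 : K) ⊗ₜ[F₀] w₀ = ∑ σ, c σ • E' (U σ) := by
    rw [hw₀def, he₀tmul, hPdef, Finset.sum_image (fun σ _ τ _ h => hUinj h), hcdef]
  have hli : LinearIndependent K (E' ∘ U) := E'.linearIndependent.comp U hUinj
  -- the first corner's multiplication on the `σ`-line wedges, and on `w₀`
  have hEact : ∀ (a : K) (σ : K ≃ₐ[F₀] K),
      LinearMap.baseChange K (exteriorPower.map (2 * k)
        ((ω'.constr K fun i => Function.update (fun _ => (1 : K)) i₀ a i • ω' i).restrictScalars F₀)) (E' (U σ)) =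
        σ a • E' (U σ) := by
    intro a σ
    apply Φ'.injective
    rw [wedgeBaseChange_naturality (2 * k) Φ' hΦ' Φ' hΦ', hE', LinearEquiv.map_smul, hE']
    exact map_baseChange_update_ιMulti_family_lineSet (fun b => ω'.constr K fun i => b i • ω' i) e' he2' hcard
      i₀ a σ (U σ) (hU σ)
  have hact_tmul : ∀ a : K, (1 : K) ⊗ₜ[F₀] exteriorPower.map (2 * k)
      ((ω'.constr K fun i => Function.update (fun _ => (1 : K)) i₀ a i • ω' i).restrictScalars F₀) w₀ =
      ∑ σ, (σ a * c σ) • (E' ∘ U) σ := by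
    intro a
    rw [← LinearMap.baseChange_tmul, hw₀tmul, map_sum]
    refine Finset.sum_congr rfl fun σ _ => ?_
    rw [map_smul, hEact, smul_smul, mul_comm (c σ) (σ a)]
    rfl
  have hact_mem : ∀ a : K, exteriorPower.map (2 * k)
      ((ω'.constr K fun i => Function.update (fun _ => (1 : K)) i₀ a i • ω' i).restrictScalars F₀) w₀ ∈ WF := by
    intro a
    rw [← tmul_one_mem_baseChange_iff (K := K), hWF, hact_tmul]
    refine Submodule.sum_mem _ fun σ _ => Submodule.smul_mem _ _ (Submodule.subset_span ?_)
    exact ⟨U σ, by rw [hPdef]; exact Finset.mem_image_of_mem U (Finset.mem_univ _), rfl⟩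
  -- `w₀ ≠ 0` and the generator statement (Tier3LemmaRWeilLine §4)
  have hw₀ne : w₀ ≠ 0 := ne_zero_of_tmul_eq_sum (E' ∘ U) hli c (hc 1) w₀ hw₀tmul
  have hgen := forall_mem_exists_eq_of_tmul_eq_sum WF hdim (E' ∘ U) hli c (hc 1) _ hact_tmul hact_mem
  rw [hw₀def] at hw₀ne hgen
  exact ⟨η, hηW, hη0, he₀mem _, hw₀ne, hgen⟩


/-- **The Weil line of LEMMA R's generator IS `∧^{2k}_K V_B` — by statement** (Deligne LNM 900 Lemma 4.3(b) on the data of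
`exists_weil_line_generator`; LEMMA-R-RESIDUE.md §4(b) + v14 §18).  The conclusion of `exists_weil_line_generator_eigen`
together with the restriction-of-scalars map `q : ⋀[F₀]^{2k} V_B → ⋀[K]^{2k} V_B`
(`Tier3WedgeRestrictScalars.exists_restrictScalars_wedge`) and, for THAT `W_F`, the six clauses of
`Tier3WeilLineRestriction.weil_line_restrictScalars` and Deligne's section of `exists_weil_line_section`:
`q` onto, `(1 ⊗ q) E′_L = 0` off the `σ`-lines, `(1 ⊗ q) E′_{L_σ}` a `σ`-eigenvector, the line images a `K`-basis of
`K ⊗ ⋀[K]^{2k} V_B`, `q` injective on `W_F`, `W_F` onto `⋀[K]^{2k} V_B`, `⋀[F₀]^{2k} V_B = W_F ⊕ ker q`, and an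
`F₀`-linear section `s` of `q` with `s(⋀[K]^{2k} V_B) = W_F`.  The generator clause (LEMMA R) closes the statement. -/
theorem exists_weil_line_generator_restrictScalars {k : ℕ} [Nonempty ι]
    (cls : ι → J) (tw : ι → K ≃ₐ[F₀] K) (hinj : Function.Injective fun i => (cls i, tw i))
    (hcard : Fintype.card ι = 2 * k)
    (ω : Module.Basis J K Vr) (ω' : Module.Basis ι K VB) (M : Vr →ₗ[F₀] VB)
    (hM : ∀ (c : K) (j : J), M (c • ω j) = ∑ i ∈ univ.filter (fun i => cls i = j), ((tw i)⁻¹ c) • ω' i)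
    [LinearOrder (J × (K ≃ₐ[F₀] K))] [LinearOrder (ι × (K ≃ₐ[F₀] K))]
    [MulAction (K ≃ₐ[F₀] K) (J × (K ≃ₐ[F₀] K))]
    (hact : ∀ (σ x : K ≃ₐ[F₀] K) (j : J), σ • (j, x) = (j, σ * x))
    [MulAction (K ≃ₐ[F₀] K) (ι × (K ≃ₐ[F₀] K))]
    (hact' : ∀ (σ x : K ≃ₐ[F₀] K) (i : ι), σ • (i, x) = (i, σ * x))
    (i₀ : ι) :
    ∃ (e : Module.Basis (J × (K ≃ₐ[F₀] K)) K (K ⊗[F₀] Vr))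
      (E : Module.Basis (Set.powersetCard (J × (K ≃ₐ[F₀] K)) (2 * k)) K (K ⊗[F₀] ⋀[F₀]^(2 * k) Vr))
      (Φ : K ⊗[F₀] ⋀[F₀]^(2 * k) Vr ≃ₗ[K] ⋀[K]^(2 * k) (K ⊗[F₀] Vr))
      (e' : Module.Basis (ι × (K ≃ₐ[F₀] K)) K (K ⊗[F₀] VB))
      (E' : Module.Basis (Set.powersetCard (ι × (K ≃ₐ[F₀] K)) (2 * k)) K (K ⊗[F₀] ⋀[F₀]^(2 * k) VB))
      (Φ' : K ⊗[F₀] ⋀[F₀]^(2 * k) VB ≃ₗ[K] ⋀[K]^(2 * k) (K ⊗[F₀] VB))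
      (WF : Submodule F₀ (⋀[F₀]^(2 * k) VB))
      (e₀ : ⋀[F₀]^(2 * k) VB →ₗ[F₀] ⋀[F₀]^(2 * k) VB)
      (q : ⋀[F₀]^(2 * k) VB →ₗ[F₀] ⋀[K]^(2 * k) VB),
      (∀ (σ x : K ≃ₐ[F₀] K) (j : J), LinearMap.rTensor Vr σ.toLinearMap (e (j, x)) = e (j, σ * x)) ∧
      (∀ (σ x : K ≃ₐ[F₀] K) (i : ι), LinearMap.rTensor VB σ.toLinearMap (e' (i, x)) = e' (i, σ * x)) ∧
      (∀ (x : K ≃ₐ[F₀] K) (j : J) (b : J → K),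
        LinearMap.lTensor K ((ω.constr K fun j => b j • ω j).restrictScalars F₀) (e (j, x)) =
          x (b j) • e (j, x)) ∧
      (∀ (x : K ≃ₐ[F₀] K) (i : ι) (b : ι → K),
        LinearMap.lTensor K ((ω'.constr K fun i => b i • ω' i).restrictScalars F₀) (e' (i, x)) =
          x (b i) • e' (i, x)) ∧
      (∀ (x : K ≃ₐ[F₀] K) (i : ι) (b : K),
        LinearMap.lTensor K ((LinearMap.lsmul K VB b).restrictScalars F₀) (e' (i, x)) = x b • e' (i, x)) ∧
      (∀ (x : K ≃ₐ[F₀] K) (j : J),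
        LinearMap.lTensor K M (e (j, x)) = ∑ i ∈ univ.filter (fun i => cls i = j), e' (i, x * tw i)) ∧
      (∀ (c : K) (v : Fin (2 * k) → Vr),
        Φ (c ⊗ₜ[F₀] exteriorPower.ιMulti F₀ (2 * k) v) =
          c • exteriorPower.ιMulti K (2 * k) (fun i => (1 : K) ⊗ₜ[F₀] v i)) ∧
      (∀ (c : K) (w : Fin (2 * k) → VB),
        Φ' (c ⊗ₜ[F₀] exteriorPower.ιMulti F₀ (2 * k) w) =
          c • exteriorPower.ιMulti K (2 * k) (fun i => (1 : K) ⊗ₜ[F₀] w i)) ∧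
      (∀ s, Φ (E s) = exteriorPower.ιMulti_family K (2 * k) e s) ∧
      (∀ s, Φ' (E' s) = exteriorPower.ιMulti_family K (2 * k) e' s) ∧
      -- the Weil line and its rational projector
      WF.baseChange K =
        Submodule.span K (E' '' {L | ∃ σ : K ≃ₐ[F₀] K, (L : Finset (ι × (K ≃ₐ[F₀] K))) = lineSet σ}) ∧
      (∀ v, e₀ v ∈ WF) ∧ (∀ w ∈ WF, e₀ w = w) ∧
      (∀ (v : ⋀[F₀]^(2 * k) VB) (L : Set.powersetCard (ι × (K ≃ₐ[F₀] K)) (2 * k)),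
        E'.repr ((1 : K) ⊗ₜ[F₀] e₀ v) L =
          if ∃ σ : K ≃ₐ[F₀] K, (L : Finset (ι × (K ≃ₐ[F₀] K))) = lineSet σ
          then E'.repr ((1 : K) ⊗ₜ[F₀] v) L else 0) ∧
      Module.finrank F₀ WF = Module.finrank F₀ K ∧
      -- Deligne's direct summand: the Weil line IS `⋀[K]^(2k) VB` through the restriction-of-scalars map `q`
      (∀ w : Fin (2 * k) → VB, q (exteriorPower.ιMulti F₀ (2 * k) w) = exteriorPower.ιMulti K (2 * k) w) ∧
      Function.Surjective q ∧
      (∀ L : Set.powersetCard (ι × (K ≃ₐ[F₀] K)) (2 * k),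
        (¬ ∃ σ : K ≃ₐ[F₀] K, (L : Finset (ι × (K ≃ₐ[F₀] K))) = lineSet σ) → q.baseChange K (E' L) = 0) ∧
      (∀ (L : Set.powersetCard (ι × (K ≃ₐ[F₀] K)) (2 * k)) (σ : K ≃ₐ[F₀] K),
        (L : Finset (ι × (K ≃ₐ[F₀] K))) = lineSet σ → ∀ b : K,
        LinearMap.lTensor K ((LinearMap.lsmul K (⋀[K]^(2 * k) VB) b).restrictScalars F₀) (q.baseChange K (E' L)) =
          σ b • q.baseChange K (E' L)) ∧
      (∀ U : (K ≃ₐ[F₀] K) → Set.powersetCard (ι × (K ≃ₐ[F₀] K)) (2 * k),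
        (∀ σ, (U σ : Finset (ι × (K ≃ₐ[F₀] K))) = lineSet σ) →
        LinearIndependent K (fun σ => q.baseChange K (E' (U σ))) ∧
        Submodule.span K (Set.range fun σ => q.baseChange K (E' (U σ))) = ⊤) ∧
      (∀ v ∈ WF, q v = 0 → v = 0) ∧
      (∀ y : ⋀[K]^(2 * k) VB, ∃ v ∈ WF, q v = y) ∧
      IsCompl WF (LinearMap.ker q) ∧
      (∃ s : ⋀[K]^(2 * k) VB →ₗ[F₀] ⋀[F₀]^(2 * k) VB,
        (∀ y, q (s y) = y) ∧ (∀ y, s y ∈ WF) ∧ (∀ w ∈ WF, s (q w) = w)) ∧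
      -- LEMMA R: the generator `e · m^* η` of the Weil line under the first corner's `K`-action
      ∀ (W : Submodule F₀ (⋀[F₀]^(2 * k) Vr)),
        (∀ s : Set.powersetCard (J × (K ≃ₐ[F₀] K)) (2 * k),
          (∃ σ, (s : Finset (J × (K ≃ₐ[F₀] K))) = reducedSet cls tw σ) → E s ∈ W.baseChange K) →
        ∃ η ∈ W, η ≠ 0 ∧
          e₀ (exteriorPower.map (2 * k) M η) ∈ WF ∧ e₀ (exteriorPower.map (2 * k) M η) ≠ 0 ∧
          ∀ x ∈ WF, ∃ a : K, x = exteriorPower.map (2 * k)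
            ((ω'.constr K fun i => Function.update (fun _ => (1 : K)) i₀ a i • ω' i).restrictScalars F₀)
            (e₀ (exteriorPower.map (2 * k) M η)) := by
  classical
  obtain ⟨e, E, Φ, e', E', Φ', WF, e₀, he1, he1', he2, he2', hscal, hMe, hΦ, hΦ', hE, hE', hWF, he₀mem, he₀id,
      hrepr, hdim, hW⟩ :=
    exists_weil_line_generator_eigen cls tw hinj hcard ω ω' M hM hact hact' i₀
  have hn0 : 0 < 2 * k := hcard ▸ Fintype.card_pos
  -- `E′` in the form `Tier3WeilLineRestriction` uses
  have hE'symm : ∀ L, E' L = Φ'.symm (exteriorPower.ιMulti_family K (2 * k) e' L) := fun L => by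
    rw [← hE' L, LinearEquiv.symm_apply_apply]
  -- the restriction-of-scalars map and Deligne's direct summand for THIS `W_F`
  obtain ⟨q, hq⟩ := exists_restrictScalars_wedge (F₀ := F₀) (K := K) (V := VB) (2 * k)
  obtain ⟨h1, h2, h3, h4, h5, h6⟩ :=
    weil_line_restrictScalars ω' hcard e' hscal Φ' hΦ' E' hE'symm WF hWF q hq
  obtain ⟨s, hs⟩ := exists_weil_line_section ω' hcard e' hscal Φ' hΦ' E' hE'symm WF hWF q hq
  exact ⟨e, E, Φ, e', E', Φ', WF, e₀, q, he1, he1', he2, he2', hscal, hMe, hΦ, hΦ', hE, hE', hWF, he₀mem, he₀id,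
    hrepr, hdim, hq, surjective_of_ιMulti_eq hn0 q hq, h1, h2, h3, h4, h5, h6, ⟨s, hs⟩, hW⟩

end GeneratorEigen

end HodgeRepro.Tier3
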